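import Summits.BirchSwinnertonDyer.BirchSwinnertonDyer.Theorems.ManinLocalTwoThreeLevelThirtySixFormsSeventyTwo
import Summits.BirchSwinnertonDyer.BirchSwinnertonDyer.Theorems.ManinLocalTwoThreeNewformSeventyTwo
import Summits.BirchSwinnertonDyer.BirchSwinnertonDyer.Theorems.ManinLocalTwoThreeAnalyticBridge
import HarnessLib

/-!
# The `η`-identities of `X₀(72) → 72a1` EXACTLY — `x′ = −2πiφ₇₂·2y`, `y′ = −2πiφ₇₂(3x² + 6)`, `y² = x³ + 6x − 7` — and
# (S2)₇₂: `Λ(φ₇₂) ⊆ Λ(−24, 28)`, the Néron lattice of `72a1 = [0, 0, 0, 6, −7]`, unconditionally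

Cell bsd-f2-manin, route `ManinLocalTwoThree` (cruxes C2 `ManinOddAtFour` stmt-22967: `2² ∣ 72`, AND C3 `ManinPrimeToThreeAtNine`
stmt-22968: `3² ∣ 72`; genus `5`), prover seat p3 gen 24.  Objects (`EtaQuotientsSeventyTwo`): `x = 1 + 𝓔`, `𝓔 = η₂η₄/(η₁₈η₃₆)`,
`y = η₆²η₁₂²/(η₁₈²η₃₆²)`, `φ₇₂ = ⅔h₁ + ⅓h₂` (`h₁ = η₄⁴η₆²/η₂²`, `h₂ = η₂⁴η₁₂²/η₄²`; p2 g27's fact-free pinning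
`NewformSeventyTwo.f_apply_eq_phi72`: `⇑D.f = φ₇₂` for EVERY `X₀(72)`-datum).

THE E₂ ROAD (no expansion at the cusps `1/9`, `1/18`, `1/36`, where `x, y` have poles and no symmetry acts): by
`EtaLogDerivativeForms`, `𝓔′ = (πi/12)·G·𝓔` and `y′ = (πi/12)·G_y·y` with the weight-`2` Eisenstein forms
`G = 2E₂(2τ) + 4E₂(4τ) − 18E₂(18τ) − 36E₂(36τ)`, `G_y = 12E₂(6τ) + 24E₂(12τ) − 36E₂(18τ) − 72E₂(36τ)` of `M₂(Γ₀(36))`, and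
`φ₇₂·y/𝓔 = ⅔A + ⅓B`, `φ₇₂(3x² + 6)/y = Σ cᵢCᵢ` are combinations of HOLOMORPHIC `η`-quotients `A, B, C₁, …, C₆ ∈ M₂(Γ₀(36))`
(`LevelThirtySixFormsSeventyTwo`, decidable Newman/Ligozat certificates).  Hence

* §1 (I2a) ⟺ `G + 32A + 16B = 0` and (I2b) ⟺ `G_y + 144C₁ + 72C₂ + 96C₃ + 48C₄ + 48C₅ + 24C₆ = 0` in `M₂(Γ₀(36))` — LINEAR
  relations, settled by Sturm's bound (`12 < 13` coefficients: (L1), (L2) of `EtaLimitsSeventyTwo`, tree `coe_eq_zero_of_isBigO_exp'`);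
* §2 (I1) `y² = x³ + 6x − 7` on `ℍ`: `(y² − x³ − 6x + 7)′ = 2yy′ − (3x² + 6)x′ = 0` by (I2a), (I2b), so the difference is constant, and
  `→ 0` at `i∞` ((L3));
* §3 **(S2)₇₂**: `(x′)² = (2πiφ₇₂)²·4y² = (2πiφ₇₂)²(4x³ + 24x − 28)`, `x` is `Γ₀(36) ⊇ Γ₀(72)`-invariant and non-degenerate
  (`4x³ + 24x − 28 = 4y² ≠ 0`), so by the analytic bridge EVERY period of `φ₇₂` lies in the lattice with invariants
  `(g₂, g₃) = (−24, 28) = (c₄/12, c₆/216)` of `72a1 = [0, 0, 0, 6, −7]` — for every `φ ∈ S₂(Γ₀(72))` with `⇑φ = φ₇₂`.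

HONEST FRAMING: unconditional (standard axioms); nothing here proves C2, C3 (all `N`), Manin's conjecture or BSD; items 22967/22968
stay OPEN.  No definition, no named fact, no sorry. [cite: Ligozat1975, Ch. 3–4] [cite: Zagier2008, §2.3] [cite: DiamondShurman2005, §1.2, Thm. 3.5.1]
[cite: CremonaAlgorithms1997, §2.10 and Table 1 (72a1)]
-/

set_option autoImplicit false
-- lint-debt: the directory name repeats the summit name (sibling precedent `ManinLocalTwoThreeEtaIdentitiesSixtyFour.lean`)
set_option linter.dupNamespace false

noncomputable section

open Complex Filter Topology Set Asymptotics Polynomial EisensteinSeries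
open UpperHalfPlane hiding I
open scoped Real Topology Manifold MatrixGroups ModularForm
open ModularForm CongruenceSubgroup
open Literature.NumberTheory.ModularForms
open Literature.NumberTheory.EllipticCurves Literature.NumberTheory.EllipticCurves.ModularForms

namespace Summit.BirchSwinnertonDyer.BirchSwinnertonDyer.Theorems.ManinLocalTwoThree.EtaIdentitiesSeventyTwo

open QRemainder EulerRemainders EulerRemaindersSeventyTwo EtaQuotientsSeventyTwo EtaLimitsSeventyTwo EtaLogDerivativeForms
open LevelThirtySixFormsSeventyTwo
open AnalyticBridge
open NewformSeventyTwo (h1_eq h2_eq)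

/-! ## §1 (I2a) `x′ = −2πiφ₇₂·2y` and (I2b) `y′ = −2πiφ₇₂·(3x² + 6)` -/

/-- **`G = −32A − 16B` on `ℍ`** (Sturm on `G + 32A + 16B ∈ M₂(Γ₀(36))`, (L1)). [cite: DiamondShurman2005, Thm. 3.5.1] -/
theorem G_eq (τ : ℍ) :
    2 * E2 (sixMulPt 2 τ) + 4 * E2 (sixMulPt 4 τ) - 18 * E2 (sixMulPt 18 τ) - 36 * E2 (sixMulPt 36 τ)
      = -32 * etaQuotient 36 (expFn [(2, -3), (4, 3), (6, 4), (12, 2), (18, -1), (36, -1)]) τ - 16 * etaQuotient 36 (expFn [(2, 3), (4, -3), (6, 2), (12, 4), (18, -1), (36, -1)]) τ := by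
  obtain ⟨G, hG⟩ := exists_modularForm_G
  obtain ⟨FA, hA⟩ := exists_modularForm_A
  obtain ⟨FB, hB⟩ := exists_modularForm_B
  set T : ModularForm (Gamma0 36) 2 := G + (32 : ℂ) • FA + (16 : ℂ) • FB with hT
  have hTapply : ∀ σ : ℍ, T σ = (2 * E2 (sixMulPt 2 σ) + 4 * E2 (sixMulPt 4 σ) - 18 * E2 (sixMulPt 18 σ) - 36 * E2 (sixMulPt 36 σ))
      + 32 * etaQuotient 36 (expFn [(2, -3), (4, 3), (6, 4), (12, 2), (18, -1), (36, -1)]) σ + 16 * etaQuotient 36 (expFn [(2, 3), (4, -3), (6, 2), (12, 4), (18, -1), (36, -1)]) σ := by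
    intro σ
    simp only [hT, ModularForm.add_apply, ModularForm.IsGLPos.smul_apply, smul_eq_mul, hG σ]
    rw [show (FA : ℍ → ℂ) σ = etaQuotient 36 (expFn [(2, -3), (4, 3), (6, 4), (12, 2), (18, -1), (36, -1)]) σ from congrFun hA σ,
      show (FB : ℍ → ℂ) σ = etaQuotient 36 (expFn [(2, 3), (4, -3), (6, 2), (12, 4), (18, -1), (36, -1)]) σ from congrFun hB σ]
  have hT0 : (⇑T) = 0 := modularForm_thirtySix_eq_zero_of_tendsto T (tendsto_L1.congr fun σ ↦ by rw [hTapply σ])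
  have e := congrFun hT0 τ
  rw [hTapply τ, Pi.zero_apply] at e
  linear_combination e

/-- **`G_y = −(144C₁ + 72C₂ + 96C₃ + 48C₄ + 48C₅ + 24C₆)` on `ℍ`** (Sturm, (L2)). [cite: DiamondShurman2005, Thm. 3.5.1] -/
theorem Gy_eq (τ : ℍ) :
    12 * E2 (sixMulPt 6 τ) + 24 * E2 (sixMulPt 12 τ) - 36 * E2 (sixMulPt 18 τ) - 72 * E2 (sixMulPt 36 τ)
      = -(144 * etaQuotient 36 (expFn [(2, -2), (4, 4), (12, -2), (18, 2), (36, 2)]) τ + 72 * etaQuotient 36 (expFn [(2, 4), (4, -2), (6, -2), (18, 2), (36, 2)]) τ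
        + 96 * etaQuotient 36 (expFn [(2, -1), (4, 5), (12, -2), (18, 1), (36, 1)]) τ + 48 * etaQuotient 36 (expFn [(2, 5), (4, -1), (6, -2), (18, 1), (36, 1)]) τ
        + 48 * etaQuotient 36 (expFn [(4, 6), (12, -2)]) τ + 24 * etaQuotient 36 (expFn [(2, 6), (6, -2)]) τ) := by
  obtain ⟨G, hG⟩ := exists_modularForm_Gy
  obtain ⟨F1, hF1⟩ := exists_modularForm_C1
  obtain ⟨F2, hF2⟩ := exists_modularForm_C2
  obtain ⟨F3, hF3⟩ := exists_modularForm_C3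
  obtain ⟨F4, hF4⟩ := exists_modularForm_C4
  obtain ⟨F5, hF5⟩ := exists_modularForm_C5
  obtain ⟨F6, hF6⟩ := exists_modularForm_C6
  set T : ModularForm (Gamma0 36) 2 := G + (144 : ℂ) • F1 + (72 : ℂ) • F2 + (96 : ℂ) • F3 + (48 : ℂ) • F4 + (48 : ℂ) • F5
    + (24 : ℂ) • F6 with hT
  have hTapply : ∀ σ : ℍ, T σ = (12 * E2 (sixMulPt 6 σ) + 24 * E2 (sixMulPt 12 σ) - 36 * E2 (sixMulPt 18 σ) - 72 * E2 (sixMulPt 36 σ))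
      + 144 * etaQuotient 36 (expFn [(2, -2), (4, 4), (12, -2), (18, 2), (36, 2)]) σ + 72 * etaQuotient 36 (expFn [(2, 4), (4, -2), (6, -2), (18, 2), (36, 2)]) σ
      + 96 * etaQuotient 36 (expFn [(2, -1), (4, 5), (12, -2), (18, 1), (36, 1)]) σ + 48 * etaQuotient 36 (expFn [(2, 5), (4, -1), (6, -2), (18, 1), (36, 1)]) σ
      + 48 * etaQuotient 36 (expFn [(4, 6), (12, -2)]) σ + 24 * etaQuotient 36 (expFn [(2, 6), (6, -2)]) σ := by
    intro σ
    simp only [hT, ModularForm.add_apply, ModularForm.IsGLPos.smul_apply, smul_eq_mul, hG σ]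
    rw [show (F1 : ℍ → ℂ) σ = etaQuotient 36 (expFn [(2, -2), (4, 4), (12, -2), (18, 2), (36, 2)]) σ from congrFun hF1 σ,
      show (F2 : ℍ → ℂ) σ = etaQuotient 36 (expFn [(2, 4), (4, -2), (6, -2), (18, 2), (36, 2)]) σ from congrFun hF2 σ,
      show (F3 : ℍ → ℂ) σ = etaQuotient 36 (expFn [(2, -1), (4, 5), (12, -2), (18, 1), (36, 1)]) σ from congrFun hF3 σ,
      show (F4 : ℍ → ℂ) σ = etaQuotient 36 (expFn [(2, 5), (4, -1), (6, -2), (18, 1), (36, 1)]) σ from congrFun hF4 σ,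
      show (F5 : ℍ → ℂ) σ = etaQuotient 36 (expFn [(4, 6), (12, -2)]) σ from congrFun hF5 σ,
      show (F6 : ℍ → ℂ) σ = etaQuotient 36 (expFn [(2, 6), (6, -2)]) σ from congrFun hF6 σ]
  have hT0 : (⇑T) = 0 := modularForm_thirtySix_eq_zero_of_tendsto T (tendsto_L2.congr fun σ ↦ by rw [hTapply σ])
  have e := congrFun hT0 τ
  rw [hTapply τ, Pi.zero_apply] at e
  linear_combination e

/-- `A·𝓔 = h₁·y` and `B·𝓔 = h₂·y` on `ℍ` (`η`-exponent bookkeeping through the Euler functions). [folklore] -/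
theorem A_mul_E_and_B_mul_E (τ : ℍ) :
    etaQuotient 36 (expFn [(2, -3), (4, 3), (6, 4), (12, 2), (18, -1), (36, -1)]) τ * etaQuotient 36 (expFn [(2, 1), (4, 1), (18, -1), (36, -1)]) τ = etaQuotient 72 (expFn [(2, -2), (4, 4), (6, 2)]) τ * etaQuotient 36 (expFn [(6, 2), (12, 2), (18, -2), (36, -2)]) τ ∧
      etaQuotient 36 (expFn [(2, 3), (4, -3), (6, 2), (12, 4), (18, -1), (36, -1)]) τ * etaQuotient 36 (expFn [(2, 1), (4, 1), (18, -1), (36, -1)]) τ = etaQuotient 72 (expFn [(2, 4), (4, -2), (12, 2)]) τ * etaQuotient 36 (expFn [(6, 2), (12, 2), (18, -2), (36, -2)]) τ := by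
  have hE2 := eulerFn_ne_zero (by norm_num : 0 < 2) τ
  have hE4 := eulerFn_ne_zero (by norm_num : 0 < 4) τ
  have hE18 := eulerFn_ne_zero (by norm_num : 0 < 18) τ
  have hE36 := eulerFn_ne_zero (by norm_num : 0 < 36) τ
  have hq := qParam_ne_zero τ
  rw [A_eq, B_eq, E_eq, y_eq, h1_eq, h2_eq]
  constructor
  · field_simp
  · field_simp

/-- `C₁y = h₁`, `C₂y = h₂`, `C₃y = h₁𝓔`, `C₄y = h₂𝓔`, `C₅y = h₁𝓔²`, `C₆y = h₂𝓔²` on `ℍ`. [folklore] -/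
theorem C_mul_y (τ : ℍ) :
    etaQuotient 36 (expFn [(2, -2), (4, 4), (12, -2), (18, 2), (36, 2)]) τ * etaQuotient 36 (expFn [(6, 2), (12, 2), (18, -2), (36, -2)]) τ = etaQuotient 72 (expFn [(2, -2), (4, 4), (6, 2)]) τ ∧
    etaQuotient 36 (expFn [(2, 4), (4, -2), (6, -2), (18, 2), (36, 2)]) τ * etaQuotient 36 (expFn [(6, 2), (12, 2), (18, -2), (36, -2)]) τ = etaQuotient 72 (expFn [(2, 4), (4, -2), (12, 2)]) τ ∧
    etaQuotient 36 (expFn [(2, -1), (4, 5), (12, -2), (18, 1), (36, 1)]) τ * etaQuotient 36 (expFn [(6, 2), (12, 2), (18, -2), (36, -2)]) τ = etaQuotient 72 (expFn [(2, -2), (4, 4), (6, 2)]) τ * etaQuotient 36 (expFn [(2, 1), (4, 1), (18, -1), (36, -1)]) τ ∧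
    etaQuotient 36 (expFn [(2, 5), (4, -1), (6, -2), (18, 1), (36, 1)]) τ * etaQuotient 36 (expFn [(6, 2), (12, 2), (18, -2), (36, -2)]) τ = etaQuotient 72 (expFn [(2, 4), (4, -2), (12, 2)]) τ * etaQuotient 36 (expFn [(2, 1), (4, 1), (18, -1), (36, -1)]) τ ∧
    etaQuotient 36 (expFn [(4, 6), (12, -2)]) τ * etaQuotient 36 (expFn [(6, 2), (12, 2), (18, -2), (36, -2)]) τ = etaQuotient 72 (expFn [(2, -2), (4, 4), (6, 2)]) τ * etaQuotient 36 (expFn [(2, 1), (4, 1), (18, -1), (36, -1)]) τ ^ 2 ∧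
    etaQuotient 36 (expFn [(2, 6), (6, -2)]) τ * etaQuotient 36 (expFn [(6, 2), (12, 2), (18, -2), (36, -2)]) τ = etaQuotient 72 (expFn [(2, 4), (4, -2), (12, 2)]) τ * etaQuotient 36 (expFn [(2, 1), (4, 1), (18, -1), (36, -1)]) τ ^ 2 := by
  have hE2 := eulerFn_ne_zero (by norm_num : 0 < 2) τ
  have hE4 := eulerFn_ne_zero (by norm_num : 0 < 4) τ
  have hE6 := eulerFn_ne_zero (by norm_num : 0 < 6) τ
  have hE12 := eulerFn_ne_zero (by norm_num : 0 < 12) τ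
  have hE18 := eulerFn_ne_zero (by norm_num : 0 < 18) τ
  have hE36 := eulerFn_ne_zero (by norm_num : 0 < 36) τ
  have hq := qParam_ne_zero τ
  rw [C1_eq, C2_eq, C3_eq, C4_eq, C5_eq, C6_eq, E_eq, y_eq, h1_eq, h2_eq]
  refine ⟨?_, ?_, ?_, ?_, ?_, ?_⟩ <;> field_simp

/-- **(I2a)₇₂: `x′ = −2πi φ₇₂ · 2y` on `ℍ`** (`x = 1 + 𝓔`; `𝓔′ = (πi/12)G𝓔`, `G = −32A − 16B`, `A𝓔 = h₁y`, `B𝓔 = h₂y`).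
[cite: Ligozat1975, Ch. 4] [cite: Zagier2008, §2.3] -/
theorem deriv_x_seventyTwo (τ : ℍ) :
    deriv ((fun σ : ℍ ↦ 1 + etaQuotient 36 (expFn [(2, 1), (4, 1), (18, -1), (36, -1)]) σ) ∘ ofComplex) τ
      = -(2 * π * I * ((2 / 3 : ℂ) * etaQuotient 72 (expFn [(2, -2), (4, 4), (6, 2)]) τ + (1 / 3 : ℂ) * etaQuotient 72 (expFn [(2, 4), (4, -2), (12, 2)]) τ)) * (2 * etaQuotient 36 (expFn [(6, 2), (12, 2), (18, -2), (36, -2)]) τ) := by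
  have hfun : ((fun σ : ℍ ↦ 1 + etaQuotient 36 (expFn [(2, 1), (4, 1), (18, -1), (36, -1)]) σ) ∘ ofComplex) = fun z ↦ 1 + (etaQuotient 36 (expFn [(2, 1), (4, 1), (18, -1), (36, -1)]) ∘ ofComplex) z := by
    funext z
    simp only [Function.comp_apply]
  rw [hfun, deriv_const_add, deriv_etaQuotient_eq_e2Comb 36 (expFn [(2, 1), (4, 1), (18, -1), (36, -1)]) τ, e2Comb_E_eq τ, G_eq τ]
  obtain ⟨hA, hB⟩ := A_mul_E_and_B_mul_E τ
  linear_combination (π * I / 12) * (-32 * hA - 16 * hB)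

/-- **(I2b)₇₂: `y′ = −2πi φ₇₂ · (3x² + 6)` on `ℍ`** (`y′ = (πi/12)G_y·y`, `G_y = −Σcᵢ Cᵢ`, `Cᵢy ∈ {h₁, h₂}·{1, 𝓔, 𝓔²}`).
[cite: Ligozat1975, Ch. 4] [cite: Zagier2008, §2.3] -/
theorem deriv_y_seventyTwo (τ : ℍ) :
    deriv (etaQuotient 36 (expFn [(6, 2), (12, 2), (18, -2), (36, -2)]) ∘ ofComplex) τ
      = -(2 * π * I * ((2 / 3 : ℂ) * etaQuotient 72 (expFn [(2, -2), (4, 4), (6, 2)]) τ + (1 / 3 : ℂ) * etaQuotient 72 (expFn [(2, 4), (4, -2), (12, 2)]) τ)) * (3 * (1 + etaQuotient 36 (expFn [(2, 1), (4, 1), (18, -1), (36, -1)]) τ) ^ 2 + 6) := by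
  rw [deriv_etaQuotient_eq_e2Comb 36 (expFn [(6, 2), (12, 2), (18, -2), (36, -2)]) τ, e2Comb_y_eq τ, Gy_eq τ]
  obtain ⟨h1, h2, h3, h4, h5, h6⟩ := C_mul_y τ
  linear_combination (π * I / 12) * (-(144 * h1 + 72 * h2 + 96 * h3 + 48 * h4 + 48 * h5 + 24 * h6))

/-! ## §2 (I1) `y² = x³ + 6x − 7` on `ℍ` -/

/-- **(I1)₇₂: `y² = x³ + 6x − 7` on `ℍ`, exactly** (`x = 1 + 𝓔`): the derivative of `y² − x³ − 6x + 7` is `2yy′ − (3x² + 6)x′ = 0` by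
(I2a), (I2b); `ℍ` is connected; the constant is `0` by (L3). [cite: CremonaAlgorithms1997, Table 1 (72a1)] -/
theorem cubic_seventyTwo (τ : ℍ) :
    etaQuotient 36 (expFn [(6, 2), (12, 2), (18, -2), (36, -2)]) τ ^ 2 = (1 + etaQuotient 36 (expFn [(2, 1), (4, 1), (18, -1), (36, -1)]) τ) ^ 3 + 6 * (1 + etaQuotient 36 (expFn [(2, 1), (4, 1), (18, -1), (36, -1)]) τ) - 7 := by
  have hxall := deriv_x_seventyTwo
  have hyall := deriv_y_seventyTwo
  set X : ℍ → ℂ := etaQuotient 36 (expFn [(2, 1), (4, 1), (18, -1), (36, -1)]) with hX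
  set Yf : ℍ → ℂ := etaQuotient 36 (expFn [(6, 2), (12, 2), (18, -2), (36, -2)]) with hYf
  have hXd := UpperHalfPlane.mdifferentiable_iff.mp (mdifferentiable_etaQuotient 36 (expFn [(2, 1), (4, 1), (18, -1), (36, -1)]))
  have hYd := UpperHalfPlane.mdifferentiable_iff.mp (mdifferentiable_etaQuotient 36 (expFn [(6, 2), (12, 2), (18, -2), (36, -2)]))
  have hderiv : ∀ z ∈ {z : ℂ | 0 < z.im}, deriv (fun z : ℂ ↦ (Yf ∘ ofComplex) z ^ 2 - (1 + (X ∘ ofComplex) z) ^ 3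
      - 6 * (1 + (X ∘ ofComplex) z) + 7) z = 0 := by
    intro z hz
    have h1 : HasDerivAt (X ∘ ofComplex) (deriv (X ∘ ofComplex) z) z :=
      ((hXd z hz).differentiableAt (isOpen_upperHalfPlaneSet.mem_nhds hz)).hasDerivAt
    have h2 : HasDerivAt (Yf ∘ ofComplex) (deriv (Yf ∘ ofComplex) z) z :=
      ((hYd z hz).differentiableAt (isOpen_upperHalfPlaneSet.mem_nhds hz)).hasDerivAt
    have h1' : HasDerivAt (fun w : ℂ ↦ 1 + (X ∘ ofComplex) w) (deriv (X ∘ ofComplex) z) z := by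
      simpa using h1.const_add 1
    have hPd := (((h2.pow 2).sub (h1'.pow 3)).sub (h1'.const_mul 6)).add_const 7
    have hfunP : (fun z : ℂ ↦ (Yf ∘ ofComplex) z ^ 2 - (1 + (X ∘ ofComplex) z) ^ 3 - 6 * (1 + (X ∘ ofComplex) z) + 7)
        = fun v ↦ ((Yf ∘ ofComplex) ^ 2 - (fun w ↦ 1 + (X ∘ ofComplex) w) ^ 3 - fun w ↦ 6 * (1 + (X ∘ ofComplex) w)) v + 7 := by
      funext w
      simp only [Pi.sub_apply, Pi.pow_apply]
    rw [hfunP, hPd.deriv]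
    have hx' := hxall ⟨z, hz⟩
    have hy' := hyall ⟨z, hz⟩
    have hcoe : ((⟨z, hz⟩ : ℍ) : ℂ) = z := rfl
    have hfun : ((fun σ : ℍ ↦ 1 + X σ) ∘ ofComplex) = fun w ↦ 1 + (X ∘ ofComplex) w := by
      funext w
      simp only [Function.comp_apply]
    rw [hfun, hcoe, deriv_const_add] at hx'
    rw [hcoe] at hy'
    rw [hx', hy']
    simp only [Function.comp_apply, ofComplex_apply_of_im_pos hz, show (3 : ℕ) - 1 = 2 from rfl, show (2 : ℕ) - 1 = 1 from rfl]
    push_cast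
    ring
  have hPdiff : DifferentiableOn ℂ (fun z : ℂ ↦ (Yf ∘ ofComplex) z ^ 2 - (1 + (X ∘ ofComplex) z) ^ 3
      - 6 * (1 + (X ∘ ofComplex) z) + 7) {z : ℂ | 0 < z.im} :=
    (((hYd.pow 2).sub ((hXd.const_add 1).pow 3)).sub ((hXd.const_add 1).const_mul 6)).add_const 7
  have hconst : ∀ z ∈ {z : ℂ | 0 < z.im}, ∀ w ∈ {z : ℂ | 0 < z.im},
      (fun z : ℂ ↦ (Yf ∘ ofComplex) z ^ 2 - (1 + (X ∘ ofComplex) z) ^ 3 - 6 * (1 + (X ∘ ofComplex) z) + 7) z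
        = (fun z : ℂ ↦ (Yf ∘ ofComplex) z ^ 2 - (1 + (X ∘ ofComplex) z) ^ 3 - 6 * (1 + (X ∘ ofComplex) z) + 7) w :=
    fun z hz w hw ↦ isOpen_upperHalfPlaneSet.is_const_of_deriv_eq_zero
      convex_setOf_im_pos.isPreconnected hPdiff hderiv hz hw
  have hlim : Tendsto (fun σ : ℍ ↦ Yf σ ^ 2 - (1 + X σ) ^ 3 - 6 * (1 + X σ) + 7) atImInfty
      (𝓝 (Yf τ ^ 2 - (1 + X τ) ^ 3 - 6 * (1 + X τ) + 7)) := by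
    refine tendsto_const_nhds.congr fun σ ↦ ?_
    have h := hconst _ τ.im_pos _ σ.im_pos
    simp only [Function.comp_apply, ofComplex_apply] at h
    exact h
  have h0 : Yf τ ^ 2 - (1 + X τ) ^ 3 - 6 * (1 + X τ) + 7 = 0 := tendsto_nhds_unique hlim tendsto_L3
  linear_combination h0

/-! ## §3 (S2)₇₂: `Λ(φ₇₂) ⊆ Λ(−24, 28)` -/

/-- `φ₇₂ = ⅔h₁ + ⅓h₂` is not the zero cusp form (it does not vanish at `τ = i`: `h₁, h₂` are `η`-quotients with positive values on the
imaginary axis — more simply, `φ₇₂·y/𝓔 = ⅔A + ⅓B` and `G = −48(⅔A + ⅓B)` has constant term `−48 ≠ 0`; we use the identity (I2a):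
`φ₇₂ = 0` would force `x′ = 0`, i.e. `𝓔` constant, contradicting `𝓔 q² → 1`). [folklore] -/
theorem phi72_ne_zero (φ : CuspForm (Gamma0 72) 2)
    (hφ : ⇑φ = fun τ ↦ (2 / 3 : ℂ) * etaQuotient 72 (expFn [(2, -2), (4, 4), (6, 2)]) τ + (1 / 3 : ℂ) * etaQuotient 72 (expFn [(2, 4), (4, -2), (12, 2)]) τ) : φ ≠ 0 := by
  intro h0
  -- `x′ = 0` everywhere, so `𝓔′ = 0`, so `G·𝓔 = 0`, so `G = 0`; but `G → −48` at `i∞`.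
  have hG0 : ∀ τ : ℍ, 2 * E2 (sixMulPt 2 τ) + 4 * E2 (sixMulPt 4 τ) - 18 * E2 (sixMulPt 18 τ) - 36 * E2 (sixMulPt 36 τ) = 0 := by
    intro τ
    have hx := deriv_x_seventyTwo τ
    have hφτ : (2 / 3 : ℂ) * etaQuotient 72 (expFn [(2, -2), (4, 4), (6, 2)]) τ + (1 / 3 : ℂ) * etaQuotient 72 (expFn [(2, 4), (4, -2), (12, 2)]) τ = φ τ := by rw [hφ]
    rw [hφτ, h0, CuspForm.zero_apply, mul_zero, neg_zero, zero_mul] at hx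
    have hfun : ((fun σ : ℍ ↦ 1 + etaQuotient 36 (expFn [(2, 1), (4, 1), (18, -1), (36, -1)]) σ) ∘ ofComplex) = fun z ↦ 1 + (etaQuotient 36 (expFn [(2, 1), (4, 1), (18, -1), (36, -1)]) ∘ ofComplex) z := by
      funext z
      simp only [Function.comp_apply]
    rw [hfun, deriv_const_add, deriv_etaQuotient_eq_e2Comb 36 (expFn [(2, 1), (4, 1), (18, -1), (36, -1)]) τ, e2Comb_E_eq τ] at hx
    have hπ : (π * I / 12 : ℂ) ≠ 0 := by simp [Real.pi_ne_zero, I_ne_zero]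
    rcases mul_eq_zero.mp hx with h1 | h1
    · rcases mul_eq_zero.mp h1 with h2 | h2
      · exact absurd h2 hπ
      · exact h2
    · exact absurd h1 (etaQuotient_ne_zero 36 _ τ)
  -- the limit of `G` at `i∞` is `2 + 4 − 18 − 36 = −48`
  have hlim : Tendsto (fun τ : ℍ ↦ 2 * E2 (sixMulPt 2 τ) + 4 * E2 (sixMulPt 4 τ) - 18 * E2 (sixMulPt 18 τ) - 36 * E2 (sixMulPt 36 τ))
      atImInfty (𝓝 (2 * 1 + 4 * 1 - 18 * 1 - 36 * 1)) := by
    have h := fun (δ : ℕ) (hδ : 0 < δ) ↦ QRemainder.tendsto_eval_zero (tendsto_E2_sixMulPt hδ 0)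
    have e : ∀ (δ : ℕ), 0 < δ → (∑ n ∈ Finset.range (0 + 1), C (e2NatMulCoeff δ n) * X ^ n).eval (0 : ℂ) = 1 := by
      intro δ hδ
      simp [e2NatMulCoeff, e2Coeff, hδ]
    have h2 := h 2 (by norm_num); have h4 := h 4 (by norm_num); have h18 := h 18 (by norm_num); have h36 := h 36 (by norm_num)
    rw [e 2 (by norm_num)] at h2
    rw [e 4 (by norm_num)] at h4
    rw [e 18 (by norm_num)] at h18
    rw [e 36 (by norm_num)] at h36
    exact (((h2.const_mul 2).add (h4.const_mul 4)).sub (h18.const_mul 18)).sub (h36.const_mul 36)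
  rw [show (fun τ : ℍ ↦ 2 * E2 (sixMulPt 2 τ) + 4 * E2 (sixMulPt 4 τ) - 18 * E2 (sixMulPt 18 τ) - 36 * E2 (sixMulPt 36 τ))
      = fun _ ↦ (0 : ℂ) from funext hG0] at hlim
  have := tendsto_nhds_unique hlim tendsto_const_nhds
  norm_num at this

/-- **(S2)₇₂ unconditionally: every period of `φ₇₂` lies in the lattice with invariants `g₂ = −24 = c₄(72a1)/12`,
`g₃ = 28 = c₆(72a1)/216`** — for every `φ ∈ S₂(Γ₀(72))` whose underlying function is `⅔h₁ + ⅓h₂` (analytic bridge with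
`(x′)² = (2πiφ)²(4x³ + 24x − 28)` from (I1)₇₂, (I2a)₇₂; non-degeneracy: `4x³ + 24x − 28 = 4y² ≠ 0`). [cite: CremonaAlgorithms1997, §2.10] -/
theorem periodLatticeLe_seventyTwo (φ : CuspForm (Gamma0 72) 2)
    (hφ : ⇑φ = fun τ ↦ (2 / 3 : ℂ) * etaQuotient 72 (expFn [(2, -2), (4, 4), (6, 2)]) τ + (1 / 3 : ℂ) * etaQuotient 72 (expFn [(2, 4), (4, -2), (12, 2)]) τ) :
    ∃ L₁ : PeriodPair, L₁.g₂ = -24 ∧ L₁.g₃ = 28 ∧ ∀ z ∈ periodLattice φ, z ∈ L₁.lattice := by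
  obtain ⟨L₁, hg2, hg3⟩ := PeriodPair.uniformization_holds (-24) 28 (by norm_num)
  have hxd : MDifferentiable 𝓘(ℂ) 𝓘(ℂ) (fun σ : ℍ ↦ 1 + etaQuotient 36 (expFn [(2, 1), (4, 1), (18, -1), (36, -1)]) σ) :=
    mdifferentiable_const.add (mdifferentiable_etaQuotient 36 _)
  refine ⟨L₁, hg2, hg3, periodLattice_le_of_deriv_sq φ (phi72_ne_zero φ hφ) L₁
    (fun σ : ℍ ↦ 1 + etaQuotient 36 (expFn [(2, 1), (4, 1), (18, -1), (36, -1)]) σ) hxd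
    x_smul72 ?_ ⟨UpperHalfPlane.I, ?_⟩⟩
  · intro τ
    rw [deriv_x_seventyTwo τ, hg2, hg3]
    simp only [hφ]
    linear_combination 4 * (2 * π * I * ((2 / 3 : ℂ) * etaQuotient 72 (expFn [(2, -2), (4, 4), (6, 2)]) τ + (1 / 3 : ℂ) * etaQuotient 72 (expFn [(2, 4), (4, -2), (12, 2)]) τ)) ^ 2 * cubic_seventyTwo τ
  · rw [hg2, hg3]
    have hy := etaQuotient_ne_zero 36 (expFn [(6, 2), (12, 2), (18, -2), (36, -2)]) UpperHalfPlane.I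
    intro h
    apply hy
    have hc := cubic_seventyTwo UpperHalfPlane.I
    have : etaQuotient 36 (expFn [(6, 2), (12, 2), (18, -2), (36, -2)]) UpperHalfPlane.I ^ 2 = 0 := by linear_combination hc + (1 / 4 : ℂ) * h
    exact pow_eq_zero_iff two_ne_zero |>.mp this

end Summit.BirchSwinnertonDyer.BirchSwinnertonDyer.Theorems.ManinLocalTwoThree.EtaIdentitiesSeventyTwo

end
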